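import Literature.Analysis.FluidPDE.OseenKernelLp
import Literature.Analysis.FunctionSpaces.MinkowskiIntegral
import Mathlib.Analysis.SpecialFunctions.Integrability.Basic
import HarnessLib

/-!
# Kato's bilinear estimates for the Oseen–Duhamel term in the weighted classes
# `t^{1/4} L⁶`, `t^{1/2} L^∞` (dimension three)

Analysis/FluidPDE support file, second layer of the discharge of Kato's weighted local existence
theorem `Literature.Analysis.FluidPDE.kato_local_L3` (`MildL3Smooth.lean`; Kato 1984, Thm. 1;
Lemarié-Rieusset 2016, Thm. 7.5). For space–time fields `u`, `v` on `(0, T) × E`, `dim E = 3`,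
in Kato's classes
`‖u(τ)‖_{L⁶} ≤ K_u τ^{-1/4}`, `‖v(τ)‖_{L⁶} ≤ K_v τ^{-1/4}`, `‖v(τ)‖_{L^∞} ≤ L_v τ^{-1/2}`,
the bilinear Duhamel (Oseen) term
`B(u, v)(t)(x) = ∫_{τ ∈ (0,t)} ∫ K(ν(t-τ), x-y)[u(τ,y), v(τ,y)] dy dτ`
(`= Fluid.oseenDuhamel ν 0 u v t x`, KNSS 2009 §4; `K = Fluid.oseenKernel`) converges absolutely
at every `(t, x)`, `0 < t < T`, and satisfies Kato's estimates (Kato 1984, (2.3)–(2.5) with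
`m = 3`, `q = 6`; Lemarié-Rieusset 2016, proof of Thm. 7.5, (7.40) and the display on PDF p. 157):

* `‖B(u,v)(t)‖_{L⁶} ≤ c ν^{-3/4} K_u K_v t^{-1/4}` (`exists_eLpNorm_six_oseenDuhamel_le`);
* `‖B(u,v)(t)(x)‖ ≤ c ν^{-3/4} K_u L_v t^{-1/2}` for **every** `x`
  (`exists_norm_oseenDuhamel_le`);
* `‖B(u,v)(t)‖_{L³} ≤ c ν^{-1/2} K_u K_v` (`exists_eLpNorm_three_oseenDuhamel_le`);

by the slice bounds of `OseenKernelLp.lean` (`‖T_σ[a,b]‖_q ≤ C σ^{-1/2-(3/2)(1/p-1/q)}‖|a||b|‖_p`),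
Minkowski's integral inequality (`Literature.Analysis.FunctionSpaces.eLpNorm_integral_le_lintegral_eLpNorm`)
and the Beta-type integrals `∫₀ᵗ (t-τ)^{-a} τ^{-b} dτ = t^{1-a-b} ∫₀¹ (1-s)^{-a} s^{-b} ds`
(`integral_sub_rpow_mul_rpow`), finite for `a, b < 1`.

## References

* T. Kato, *Strong `L^p`-solutions of the Navier–Stokes equation in `ℝ^m`, with applications to
  weak solutions*, Math. Z. 187 (1984) 471–480, §2, (2.3)–(2.5).
* P. G. Lemarié-Rieusset, *The Navier–Stokes Problem in the 21st Century*, CRC Press 2016,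
  Thm. 7.5 and its proof, (7.40) (PDF pp. 155–158).
-/

noncomputable section

open MeasureTheory TopologicalSpace Set Function Filter Topology InnerProductSpace Metric
open scoped RealInnerProductSpace ENNReal NNReal

namespace Literature.Analysis.FluidPDE

/-! ### Beta-type integrals `∫₀ᵗ (t-τ)^{-a} τ^{-b} dτ` -/

section Beta

/-- On `(0, 1)`: `(1-s)^{-a} s^{-b} ≤ 2^a s^{-b} + 2^b (1-s)^{-a}` for `a, b ≥ 0` (split at
`s = 1/2`). [folklore] -/
theorem one_sub_rpow_mul_rpow_le {a b : ℝ} (ha : 0 ≤ a) (hb : 0 ≤ b) {s : ℝ} (hs : s ∈ Ioo (0 : ℝ) 1) :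
    (1 - s) ^ (-a) * s ^ (-b) ≤ 2 ^ a * s ^ (-b) + 2 ^ b * (1 - s) ^ (-a) := by
  have hs1 : 0 < 1 - s := by linarith [hs.2]
  have h1 : 0 ≤ (1 - s) ^ (-a) := Real.rpow_nonneg hs1.le _
  have h2 : 0 ≤ s ^ (-b) := Real.rpow_nonneg hs.1.le _
  have hhalf : ((1 / 2 : ℝ)) ^ (-a) = 2 ^ a := by
    rw [Real.rpow_neg (by norm_num), ← Real.inv_rpow (by norm_num)]; norm_num
  have hhalf' : ((1 / 2 : ℝ)) ^ (-b) = 2 ^ b := by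
    rw [Real.rpow_neg (by norm_num), ← Real.inv_rpow (by norm_num)]; norm_num
  rcases le_or_gt s (1 / 2) with hle | hgt
  · have hA : (1 - s) ^ (-a) ≤ 2 ^ a := by
      rw [← hhalf]
      exact Real.rpow_le_rpow_of_nonpos (by norm_num) (by linarith) (by linarith)
    calc (1 - s) ^ (-a) * s ^ (-b) ≤ 2 ^ a * s ^ (-b) := by gcongr
      _ ≤ 2 ^ a * s ^ (-b) + 2 ^ b * (1 - s) ^ (-a) := le_add_of_nonneg_right (by positivity)
  · have hB : s ^ (-b) ≤ 2 ^ b := by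
      rw [← hhalf']
      exact Real.rpow_le_rpow_of_nonpos (by norm_num) hgt.le (by linarith)
    calc (1 - s) ^ (-a) * s ^ (-b) ≤ (1 - s) ^ (-a) * 2 ^ b := by gcongr
      _ = 2 ^ b * (1 - s) ^ (-a) := mul_comm _ _
      _ ≤ 2 ^ a * s ^ (-b) + 2 ^ b * (1 - s) ^ (-a) := le_add_of_nonneg_left (by positivity)

/-- **The Beta integrand is integrable on `(0, 1)`**: `s ↦ (1-s)^{-a} s^{-b}` for `0 ≤ a, b < 1`.
[folklore] -/
theorem intervalIntegrable_one_sub_rpow_mul_rpow {a b : ℝ} (ha0 : 0 ≤ a) (ha : a < 1) (hb0 : 0 ≤ b)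
    (hb : b < 1) :
    IntervalIntegrable (fun s : ℝ => (1 - s) ^ (-a) * s ^ (-b)) volume 0 1 := by
  have hg1 : IntervalIntegrable (fun s : ℝ => (2 : ℝ) ^ a * s ^ (-b)) volume 0 1 :=
    (intervalIntegral.intervalIntegrable_rpow' (by linarith)).const_mul _
  have hg2 : IntervalIntegrable (fun s : ℝ => (2 : ℝ) ^ b * (1 - s) ^ (-a)) volume 0 1 := by
    have h := (intervalIntegral.intervalIntegrable_rpow' (a := 0) (b := 1) (r := -a)
      (by linarith)).comp_sub_left 1
    simp only [sub_zero, sub_self] at h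
    exact h.symm.const_mul _
  refine (hg1.add hg2).mono_fun' ?_ ?_
  · exact ((measurable_const.sub measurable_id).pow_const _).mul (measurable_id.pow_const _)
      |>.aestronglyMeasurable
  · rw [uIoc_of_le zero_le_one]
    refine (ae_restrict_iff' measurableSet_Ioc).2 ?_
    have hne : ∀ᵐ s : ℝ ∂volume, s ≠ 1 := measure_eq_zero_iff_ae_notMem.1 Real.volume_singleton
    filter_upwards [hne] with s hs1 hs
    have hs' : s ∈ Ioo (0 : ℝ) 1 := ⟨hs.1, lt_of_le_of_ne hs.2 hs1⟩
    rw [Real.norm_of_nonneg (mul_nonneg (Real.rpow_nonneg (by linarith [hs'.2]) _)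
      (Real.rpow_nonneg hs'.1.le _))]
    exact one_sub_rpow_mul_rpow_le ha0 hb0 hs'

/-- **The Beta integrand is integrable on `(0, t)`** (scaling of the `(0,1)` case). [folklore] -/
theorem intervalIntegrable_sub_rpow_mul_rpow {a b : ℝ} (ha0 : 0 ≤ a) (ha : a < 1) (hb0 : 0 ≤ b)
    (hb : b < 1) {t : ℝ} (ht : 0 < t) :
    IntervalIntegrable (fun τ : ℝ => (t - τ) ^ (-a) * τ ^ (-b)) volume 0 t := by
  have h := (intervalIntegrable_one_sub_rpow_mul_rpow ha0 ha hb0 hb).comp_mul_left (c := t⁻¹)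
  rw [zero_div, one_div, inv_inv] at h
  have h' := h.const_mul (t ^ (-a - b))
  refine h'.congr ?_
  rw [uIoc_of_le ht.le]
  intro τ hτ
  have hτ0 : 0 ≤ τ := hτ.1.le
  show t ^ (-a - b) * ((1 - t⁻¹ * τ) ^ (-a) * (t⁻¹ * τ) ^ (-b)) = (t - τ) ^ (-a) * τ ^ (-b)
  have h1 : 1 - t⁻¹ * τ = t⁻¹ * (t - τ) := by field_simp
  rw [h1, Real.mul_rpow (inv_nonneg.2 ht.le) (by linarith [hτ.2]),
    Real.mul_rpow (inv_nonneg.2 ht.le) hτ0, Real.inv_rpow ht.le, Real.inv_rpow ht.le,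
    Real.rpow_neg ht.le, Real.rpow_neg ht.le, inv_inv, inv_inv]
  have hsplit : t ^ (-a - b) = (t ^ a * t ^ b)⁻¹ := by
    rw [show -a - b = -(a + b) by ring, Real.rpow_neg ht.le, Real.rpow_add ht]
  rw [hsplit]
  have hta : t ^ a ≠ 0 := (Real.rpow_pos_of_pos ht a).ne'
  have htb : t ^ b ≠ 0 := (Real.rpow_pos_of_pos ht b).ne'
  field_simp

/-- **Scaling of the Beta-type integral**:
`∫₀ᵗ (t-τ)^{-a} τ^{-b} dτ = t^{1-a-b} ∫₀¹ (1-s)^{-a} s^{-b} ds`. [folklore] -/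
theorem integral_sub_rpow_mul_rpow {a b : ℝ} {t : ℝ} (ht : 0 < t) :
    ∫ τ in (0 : ℝ)..t, (t - τ) ^ (-a) * τ ^ (-b) =
      t ^ (1 - a - b) * ∫ s in (0 : ℝ)..1, (1 - s) ^ (-a) * s ^ (-b) := by
  have hscale := intervalIntegral.integral_comp_mul_left (fun τ : ℝ => (t - τ) ^ (-a) * τ ^ (-b))
    (a := 0) (b := 1) ht.ne'
  simp only [mul_zero, mul_one, smul_eq_mul] at hscale
  -- `∫₀ᵗ g = t ∫₀¹ g(t s) ds`
  have h1 : ∫ τ in (0 : ℝ)..t, (t - τ) ^ (-a) * τ ^ (-b) =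
      t * ∫ s in (0 : ℝ)..1, (t - t * s) ^ (-a) * (t * s) ^ (-b) := by
    rw [hscale, ← mul_assoc, mul_inv_cancel₀ ht.ne', one_mul]
  rw [h1]
  have h2 : ∫ s in (0 : ℝ)..1, (t - t * s) ^ (-a) * (t * s) ^ (-b) =
      ∫ s in (0 : ℝ)..1, t ^ (-a - b) * ((1 - s) ^ (-a) * s ^ (-b)) := by
    refine intervalIntegral.integral_congr fun s hs => ?_
    rw [uIcc_of_le zero_le_one] at hs
    have hfac : t - t * s = t * (1 - s) := by ring
    show (t - t * s) ^ (-a) * (t * s) ^ (-b) = t ^ (-a - b) * ((1 - s) ^ (-a) * s ^ (-b))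
    rw [hfac, Real.mul_rpow ht.le (by linarith [hs.2]), Real.mul_rpow ht.le hs.1,
      show -a - b = -a + -b by ring, Real.rpow_add ht]
    ring
  rw [h2, intervalIntegral.integral_const_mul, ← mul_assoc]
  congr 1
  rw [show (1 : ℝ) - a - b = 1 + (-a - b) by ring, Real.rpow_add ht, Real.rpow_one]

/-- The Beta-type integral over `(0, t)` as a set integral, and its nonnegativity. [folklore] -/
theorem setIntegral_Ioo_sub_rpow_mul_rpow {a b : ℝ} {t : ℝ} (ht : 0 < t) :
    ∫ τ in Ioo 0 t, (t - τ) ^ (-a) * τ ^ (-b) =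
      t ^ (1 - a - b) * ∫ s in (0 : ℝ)..1, (1 - s) ^ (-a) * s ^ (-b) := by
  rw [← integral_sub_rpow_mul_rpow ht, intervalIntegral.integral_of_le ht.le,
    integral_Ioc_eq_integral_Ioo]

/-- The constant `∫₀¹ (1-s)^{-a} s^{-b} ds` is nonnegative. [folklore] -/
theorem integral_one_sub_rpow_mul_rpow_nonneg (a b : ℝ) :
    0 ≤ ∫ s in (0 : ℝ)..1, (1 - s) ^ (-a) * s ^ (-b) := by
  refine intervalIntegral.integral_nonneg zero_le_one fun s hs => ?_
  exact mul_nonneg (Real.rpow_nonneg (by linarith [hs.2]) _) (Real.rpow_nonneg hs.1 _)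

/-- **The weighted time integral in `ℝ≥0∞`**: for `0 ≤ a, b < 1`, `c ≥ 0` and `t > 0`,
`∫⁻_{τ ∈ (0,t)} ofReal (c (t-τ)^{-a} τ^{-b}) = ofReal (c t^{1-a-b} ∫₀¹ (1-s)^{-a}s^{-b} ds)`.
[folklore] -/
theorem lintegral_Ioo_ofReal_sub_rpow_mul_rpow {a b : ℝ} (ha0 : 0 ≤ a) (ha : a < 1) (hb0 : 0 ≤ b)
    (hb : b < 1) {c t : ℝ} (hc : 0 ≤ c) (ht : 0 < t) :
    ∫⁻ τ in Ioo 0 t, ENNReal.ofReal (c * ((t - τ) ^ (-a) * τ ^ (-b))) =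
      ENNReal.ofReal (c * (t ^ (1 - a - b) * ∫ s in (0 : ℝ)..1, (1 - s) ^ (-a) * s ^ (-b))) := by
  have hint : IntegrableOn (fun τ : ℝ => c * ((t - τ) ^ (-a) * τ ^ (-b))) (Ioo 0 t) volume := by
    have h := (intervalIntegrable_sub_rpow_mul_rpow ha0 ha hb0 hb ht).const_mul c
    rw [intervalIntegrable_iff_integrableOn_Ioo_of_le ht.le] at h
    exact h
  have hnn : 0 ≤ᵐ[volume.restrict (Ioo 0 t)] fun τ : ℝ => c * ((t - τ) ^ (-a) * τ ^ (-b)) := by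
    refine (ae_restrict_iff' measurableSet_Ioo).2 (Eventually.of_forall fun τ hτ => ?_)
    exact mul_nonneg hc (mul_nonneg (Real.rpow_nonneg (by linarith [hτ.2]) _)
      (Real.rpow_nonneg hτ.1.le _))
  rw [← ofReal_integral_eq_lintegral_ofReal hint hnn, integral_const_mul,
    setIntegral_Ioo_sub_rpow_mul_rpow ht]

end Beta

/-! ### Hölder triples used -/

section Exponents

/-- The Hölder triple `(6, 6, 3)`: `6⁻¹ + 6⁻¹ = 3⁻¹`. [folklore] -/
theorem holderTriple_six_six_three : ENNReal.HolderTriple 6 6 3 := by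
  refine ⟨?_⟩
  have h : ENNReal.ofReal 6⁻¹ + ENNReal.ofReal 6⁻¹ = ENNReal.ofReal 3⁻¹ := by
    rw [← ENNReal.ofReal_add (by positivity) (by positivity)]
    norm_num
  rw [ENNReal.ofReal_inv_of_pos (by norm_num), ENNReal.ofReal_inv_of_pos (by norm_num),
    ENNReal.ofReal_ofNat, ENNReal.ofReal_ofNat] at h
  exact h

/-- The Hölder pair `(6/5, 6)`: `(6/5)⁻¹ + 6⁻¹ = 1`. [folklore] -/
theorem holderTriple_sixFifths_six_one : ENNReal.HolderTriple (6 / 5) 6 1 := by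
  refine ⟨?_⟩
  have h : ENNReal.ofReal (6 / 5)⁻¹ + ENNReal.ofReal 6⁻¹ = ENNReal.ofReal 1⁻¹ := by
    rw [← ENNReal.ofReal_add (by positivity) (by positivity)]
    norm_num
  rw [ENNReal.ofReal_inv_of_pos (by norm_num), ENNReal.ofReal_inv_of_pos (by norm_num),
    ENNReal.ofReal_inv_of_pos (by norm_num), ENNReal.ofReal_div_of_pos (by norm_num)] at h
  simpa only [ENNReal.ofReal_ofNat, ENNReal.ofReal_one] using h

end Exponents

/-! ### The Oseen–Duhamel integrand and its slices -/

section Integrand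

variable {E : Type*} [NormedAddCommGroup E] [InnerProductSpace ℝ E] [FiniteDimensional ℝ E]
  [MeasurableSpace E] [BorelSpace E]

/-- **Joint measurability of the Oseen–Duhamel integrand** `(τ, x) ↦ ∫ K(ν(t-τ), x-y)[u(τ,y), v(τ,y)] dy`
for jointly measurable `u`, `v` (Fubini measurability, `measurable_oseenKernel`). [folklore] -/
theorem stronglyMeasurable_oseenIntegrand {u v : ℝ → E → E} (hum : Measurable (uncurry u))
    (hvm : Measurable (uncurry v)) (ν t : ℝ) :
    StronglyMeasurable (uncurry fun (τ : ℝ) (x : E) =>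
      ∫ y, oseenKernel (ν * (t - τ)) (x - y) (u τ y) (v τ y)) := by
  have h1 : Measurable (fun q : (ℝ × E) × E =>
      ((ν * (t - q.1.1), q.1.2 - q.2, u q.1.1 q.2, v q.1.1 q.2) : ℝ × E × E × E)) := by
    have hu' : Measurable (fun q : (ℝ × E) × E => u q.1.1 q.2) :=
      hum.comp (measurable_fst.fst.prodMk measurable_snd)
    have hv' : Measurable (fun q : (ℝ × E) × E => v q.1.1 q.2) :=
      hvm.comp (measurable_fst.fst.prodMk measurable_snd)
    exact (measurable_const.mul (measurable_const.sub measurable_fst.fst)).prodMk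
      ((measurable_fst.snd.sub measurable_snd).prodMk (hu'.prodMk hv'))
  exact ((measurable_oseenKernel.comp h1).stronglyMeasurable).integral_prod_right'

omit [NormedAddCommGroup E] [InnerProductSpace ℝ E] [FiniteDimensional ℝ E] [BorelSpace E] in
/-- Slices of a jointly measurable field are measurable. [folklore] -/
theorem measurable_slice {E : Type*} [MeasurableSpace E] {u : ℝ → E → E}
    (hum : Measurable (uncurry u)) (τ : ℝ) :
    Measurable (u τ) :=
  hum.comp (measurable_const.prodMk measurable_id)

variable (hE : Module.finrank ℝ E = 3)
include hE

/-- **`L⁶` size of a slice of the integrand**: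
`‖T_{ν(t-τ)}[u(τ), v(τ)]‖_{L⁶} ≤ C (ν(t-τ))^{-3/4} ‖u(τ)‖_{L⁶} ‖v(τ)‖_{L⁶}` (dimension three:
`-1/2 - (3/2)(1/3 - 1/6) = -3/4`). [cite: LemarieRieusset2016, Thm. 7.5 (proof, (7.40))] -/
theorem exists_eLpNorm_six_oseenSlice_le :
    ∃ C : ℝ, 0 ≤ C ∧ ∀ {σ : ℝ}, 0 < σ → ∀ {a b : E → E}, AEStronglyMeasurable a volume →
      AEStronglyMeasurable b volume →
        eLpNorm (fun x => ∫ y, oseenKernel σ (x - y) (a y) (b y)) 6 volume ≤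
          ENNReal.ofReal (C * σ ^ (-(3 / 4 : ℝ))) * (eLpNorm a 6 volume * eLpNorm b 6 volume) := by
  haveI := holderTriple_six_six_three
  obtain ⟨C, hC, h⟩ := exists_eLpNorm_oseenSlice_le (E := E) (p := 3) (q := 6) (by norm_num)
    (by norm_num) (by norm_num)
  refine ⟨C, hC, fun {σ} hσ {a b} ha hb => ?_⟩
  have hexp : -(1 / 2 : ℝ) - (Module.finrank ℝ E : ℝ) / 2 * (1 / (3 : ℝ≥0∞).toReal -
      1 / (6 : ℝ≥0∞).toReal) = -(3 / 4 : ℝ) := by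
    rw [hE]; norm_num
  have h' := h hσ ha hb
  rw [hexp] at h'
  exact h'.trans (mul_le_mul' le_rfl (eLpNorm_norm_mul_norm_le ha hb 6 6 3))

omit hE in
/-- **`L³` size of a slice**: `‖T_σ[a, b]‖_{L³} ≤ C σ^{-1/2} ‖a‖_{L⁶} ‖b‖_{L⁶}`. [cite: LemarieRieusset2016, Thm. 7.5 (proof, PDF p. 157)] -/
theorem exists_eLpNorm_three_oseenSlice_le :
    ∃ C : ℝ, 0 ≤ C ∧ ∀ {σ : ℝ}, 0 < σ → ∀ {a b : E → E}, AEStronglyMeasurable a volume →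
      AEStronglyMeasurable b volume →
        eLpNorm (fun x => ∫ y, oseenKernel σ (x - y) (a y) (b y)) 3 volume ≤
          ENNReal.ofReal (C * σ ^ (-(1 / 2 : ℝ))) * (eLpNorm a 6 volume * eLpNorm b 6 volume) := by
  haveI := holderTriple_six_six_three
  obtain ⟨C, hC, hK⟩ := exists_norm_oseenKernel_le (E := E)
  set M₁ : ℝ := ∫ w : E, (1 + ‖w‖ ^ 2) ^ (-(((Module.finrank ℝ E : ℝ) + 1) / 2)) with hM₁
  have hM₁0 : 0 < M₁ := integral_one_add_norm_sq_rpow_neg_pos (by linarith)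
  refine ⟨C * M₁, by positivity, fun {σ} hσ {a b} ha hb => ?_⟩
  have h := eLpNorm_oseenSlice_le_same hC.le hK hσ ha hb (p := 3) (by norm_num)
  have heq : C * (σ ^ (-(1 / 2 : ℝ)) * M₁) = C * M₁ * σ ^ (-(1 / 2 : ℝ)) := by ring
  rw [heq] at h
  exact h.trans (mul_le_mul' le_rfl (eLpNorm_norm_mul_norm_le ha hb 6 6 3))

/-- **Pointwise size of a slice**: `‖T_σ[a, b](x)‖ ≤ C σ^{-3/4} ‖a‖_{L⁶} ‖b‖_{L^∞}` for every
`x` (Hölder `6/5 · 6` with the `L^{6/5}` size of the envelope, `3/(2·6/5) - 2 = -3/4`). [cite: LemarieRieusset2016, Thm. 7.5 (proof, (7.40))] -/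
theorem exists_enorm_oseenSlice_le :
    ∃ C : ℝ, 0 ≤ C ∧ ∀ {σ : ℝ}, 0 < σ → ∀ {a b : E → E}, AEStronglyMeasurable a volume →
      AEStronglyMeasurable b volume → ∀ x : E,
        ‖∫ y, oseenKernel σ (x - y) (a y) (b y)‖ₑ ≤
          ENNReal.ofReal (C * σ ^ (-(3 / 4 : ℝ))) * (eLpNorm a 6 volume * eLpNorm b ∞ volume) := by
  haveI := holderTriple_sixFifths_six_one
  obtain ⟨C, hC, hK⟩ := exists_norm_oseenKernel_le (E := E)
  obtain ⟨B, hB0, hB⟩ := exists_eLpNorm_oseenEnvelope_le (E := E) hC.le (r := 6 / 5)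
    (by
      rw [ENNReal.le_div_iff_mul_le (Or.inl (by norm_num)) (Or.inl (by norm_num))]
      norm_num)
    (ENNReal.div_ne_top (by norm_num) (by norm_num))
  refine ⟨B, hB0, fun {σ} hσ {a b} ha hb x => ?_⟩
  have hexp : (Module.finrank ℝ E : ℝ) / (2 * (6 / 5 : ℝ≥0∞).toReal) -
      ((Module.finrank ℝ E : ℝ) + 1) / 2 = -(3 / 4 : ℝ) := by
    rw [hE, ENNReal.toReal_div, ENNReal.toReal_ofNat, ENNReal.toReal_ofNat]; norm_num
  have h1 := enorm_oseenSlice_le_eLpNorm_mul hC.le hK hσ ha hb (6 / 5) 6 x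
  have h2 := hB σ hσ
  rw [hexp] at h2
  have h3 : eLpNorm (fun y => ‖a y‖ * ‖b y‖) 6 volume ≤ eLpNorm a 6 volume * eLpNorm b ∞ volume :=
    eLpNorm_norm_mul_norm_le ha hb 6 ∞ 6
  exact h1.trans (mul_le_mul' h2 h3)

end Integrand

/-! ### Kato's estimates for the Oseen–Duhamel term -/

section Duhamel

variable {E : Type*} [NormedAddCommGroup E] [InnerProductSpace ℝ E] [FiniteDimensional ℝ E]
  [MeasurableSpace E] [BorelSpace E]

/-- Measurability of the Oseen–Duhamel integrand for Minkowski's inequality (swap of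
`stronglyMeasurable_oseenIntegrand`). [folklore] -/
theorem aestronglyMeasurable_oseenIntegrand_swap {u v : ℝ → E → E} (hum : Measurable (uncurry u))
    (hvm : Measurable (uncurry v)) (ν t : ℝ) (μ' : Measure ℝ) :
    AEStronglyMeasurable (uncurry fun (x : E) (τ : ℝ) =>
      ∫ y, oseenKernel (ν * (t - τ)) (x - y) (u τ y) (v τ y)) ((volume : Measure E).prod μ') := by
  have h : (uncurry fun (x : E) (τ : ℝ) => ∫ y, oseenKernel (ν * (t - τ)) (x - y) (u τ y) (v τ y)) =
      (uncurry fun (τ : ℝ) (x : E) => ∫ y, oseenKernel (ν * (t - τ)) (x - y) (u τ y) (v τ y)) ∘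
        Prod.swap := by
    funext q; rfl
  rw [h]
  exact ((stronglyMeasurable_oseenIntegrand hum hvm ν t).comp_measurable measurable_swap).aestronglyMeasurable

/-- `τ^{-1/4} τ^{-1/4} = τ^{-1/2}` and `τ^{-1/4} τ^{-1/2} = τ^{-3/4}` for `τ > 0`. [folklore] -/
theorem rpow_quarter_mul {τ : ℝ} (hτ : 0 < τ) :
    τ ^ (-(1 / 4 : ℝ)) * τ ^ (-(1 / 4 : ℝ)) = τ ^ (-(1 / 2 : ℝ)) ∧
      τ ^ (-(1 / 4 : ℝ)) * τ ^ (-(1 / 2 : ℝ)) = τ ^ (-(3 / 4 : ℝ)) := by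
  constructor
  · rw [← Real.rpow_add hτ]; norm_num
  · rw [← Real.rpow_add hτ]; norm_num

variable (hE : Module.finrank ℝ E = 3)
include hE

/-- **Kato's `L⁶` estimate of the Oseen–Duhamel term** (Kato 1984, (2.3)–(2.4), `m = 3`,
`q = 6`; Lemarié-Rieusset 2016, (7.40) with `β = 1/4`): there is an absolute `c` such that for
`ν > 0`, jointly measurable `u`, `v` with `‖u(τ)‖_{L⁶} ≤ K_u τ^{-1/4}`, `‖v(τ)‖_{L⁶} ≤ K_v τ^{-1/4}`
on `(0, t)`,
`‖∫_{(0,t)} ∫ K(ν(t-τ), ·-y)[u(τ,y), v(τ,y)] dy dτ‖_{L⁶} ≤ c ν^{-3/4} K_u K_v t^{-1/4}`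
(Minkowski in `τ`, the slice bound `∝ (ν(t-τ))^{-3/4}`, and `∫₀ᵗ (t-τ)^{-3/4}τ^{-1/2} dτ = B t^{-1/4}`). [cite: Kato1984, (2.3)–(2.4)] [cite: LemarieRieusset2016, Thm. 7.5 (proof, (7.40))] -/
theorem exists_eLpNorm_six_oseenDuhamel_le :
    ∃ c : ℝ, 0 ≤ c ∧ ∀ {ν : ℝ}, 0 < ν → ∀ {u v : ℝ → E → E}, Measurable (uncurry u) →
      Measurable (uncurry v) → ∀ {Ku Kv : ℝ}, 0 ≤ Ku → 0 ≤ Kv → ∀ {t : ℝ}, 0 < t →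
        (∀ τ ∈ Ioo 0 t, eLpNorm (u τ) 6 volume ≤ ENNReal.ofReal (Ku * τ ^ (-(1 / 4 : ℝ)))) →
        (∀ τ ∈ Ioo 0 t, eLpNorm (v τ) 6 volume ≤ ENNReal.ofReal (Kv * τ ^ (-(1 / 4 : ℝ)))) →
          eLpNorm (fun x => ∫ τ in Ioo 0 t, ∫ y, oseenKernel (ν * (t - τ)) (x - y) (u τ y) (v τ y))
              6 volume ≤
            ENNReal.ofReal (c * ν ^ (-(3 / 4 : ℝ)) * Ku * Kv * t ^ (-(1 / 4 : ℝ))) := by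
  obtain ⟨C, hC, hS⟩ := exists_eLpNorm_six_oseenSlice_le hE
  set I : ℝ := ∫ s in (0 : ℝ)..1, (1 - s) ^ (-(3 / 4 : ℝ)) * s ^ (-(1 / 2 : ℝ)) with hI
  have hI0 : 0 ≤ I := integral_one_sub_rpow_mul_rpow_nonneg _ _
  refine ⟨C * I, by positivity, fun {ν} hν {u v} hum hvm {Ku Kv} hKu hKv {t} ht hu6 hv6 => ?_⟩
  set S : ℝ → E → E := fun τ x => ∫ y, oseenKernel (ν * (t - τ)) (x - y) (u τ y) (v τ y) with hSdef
  have hMink := FunctionSpaces.eLpNorm_integral_le_lintegral_eLpNorm (μ := (volume : Measure E))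
    (ν := volume.restrict (Ioo 0 t)) (aestronglyMeasurable_oseenIntegrand_swap hum hvm ν t _)
    (p := 6) (by norm_num) (by norm_num)
  have hslice : ∀ τ ∈ Ioo 0 t, eLpNorm (S τ) 6 volume ≤
      ENNReal.ofReal (C * ν ^ (-(3 / 4 : ℝ)) * Ku * Kv * ((t - τ) ^ (-(3 / 4 : ℝ)) * τ ^ (-(1 / 2 : ℝ)))) := by
    intro τ hτ
    have hστ : 0 < t - τ := sub_pos.2 hτ.2
    have hσ : 0 < ν * (t - τ) := mul_pos hν hστ
    have h1 := hS hσ (measurable_slice hum τ).aestronglyMeasurable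
      (measurable_slice hvm τ).aestronglyMeasurable
    refine h1.trans ?_
    calc ENNReal.ofReal (C * (ν * (t - τ)) ^ (-(3 / 4 : ℝ))) * (eLpNorm (u τ) 6 volume * eLpNorm (v τ) 6 volume)
        ≤ ENNReal.ofReal (C * (ν * (t - τ)) ^ (-(3 / 4 : ℝ))) *
            (ENNReal.ofReal (Ku * τ ^ (-(1 / 4 : ℝ))) * ENNReal.ofReal (Kv * τ ^ (-(1 / 4 : ℝ)))) := by
          gcongr
          · exact hu6 τ hτ
          · exact hv6 τ hτ
      _ = ENNReal.ofReal (C * ν ^ (-(3 / 4 : ℝ)) * Ku * Kv * ((t - τ) ^ (-(3 / 4 : ℝ)) * τ ^ (-(1 / 2 : ℝ)))) := by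
          have hτ0 : 0 < τ := hτ.1
          rw [← ENNReal.ofReal_mul (by positivity),
            ← ENNReal.ofReal_mul (mul_nonneg hC (Real.rpow_nonneg hσ.le _))]
          congr 1
          rw [Real.mul_rpow hν.le hστ.le, ← (rpow_quarter_mul hτ.1).1]
          ring
  calc eLpNorm (fun x => ∫ τ in Ioo 0 t, S τ x) 6 volume
      ≤ ∫⁻ τ in Ioo 0 t, eLpNorm (fun x => S τ x) 6 volume := hMink
    _ ≤ ∫⁻ τ in Ioo 0 t, ENNReal.ofReal (C * ν ^ (-(3 / 4 : ℝ)) * Ku * Kv *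
          ((t - τ) ^ (-(3 / 4 : ℝ)) * τ ^ (-(1 / 2 : ℝ)))) :=
        setLIntegral_mono' measurableSet_Ioo fun τ hτ => hslice τ hτ
    _ = ENNReal.ofReal (C * ν ^ (-(3 / 4 : ℝ)) * Ku * Kv * (t ^ (1 - 3 / 4 - 1 / 2 : ℝ) * I)) :=
        lintegral_Ioo_ofReal_sub_rpow_mul_rpow (by norm_num) (by norm_num) (by norm_num) (by norm_num)
          (by positivity) ht
    _ = ENNReal.ofReal (C * I * ν ^ (-(3 / 4 : ℝ)) * Ku * Kv * t ^ (-(1 / 4 : ℝ))) := by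
        rw [show (1 - 3 / 4 - 1 / 2 : ℝ) = -(1 / 4 : ℝ) by norm_num]
        ring_nf

omit hE in
/-- **Kato's `L³` estimate of the Oseen–Duhamel term** (Lemarié-Rieusset 2016, proof of Thm. 7.5,
PDF p. 157: `‖B(F,G)‖₃ ≤ C ∫₀ᵗ (t-s)^{-1+2β} s^{-2β} ds ‖F‖‖G‖ = C'‖F‖‖G‖`): under the same
hypotheses, `‖∫_{(0,t)} ∫ K[u, v]‖_{L³} ≤ c ν^{-1/2} K_u K_v`, uniformly in `t`. [cite: LemarieRieusset2016, Thm. 7.5 (proof, PDF p. 157)] -/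
theorem exists_eLpNorm_three_oseenDuhamel_le :
    ∃ c : ℝ, 0 ≤ c ∧ ∀ {ν : ℝ}, 0 < ν → ∀ {u v : ℝ → E → E}, Measurable (uncurry u) →
      Measurable (uncurry v) → ∀ {Ku Kv : ℝ}, 0 ≤ Ku → 0 ≤ Kv → ∀ {t : ℝ}, 0 < t →
        (∀ τ ∈ Ioo 0 t, eLpNorm (u τ) 6 volume ≤ ENNReal.ofReal (Ku * τ ^ (-(1 / 4 : ℝ)))) →
        (∀ τ ∈ Ioo 0 t, eLpNorm (v τ) 6 volume ≤ ENNReal.ofReal (Kv * τ ^ (-(1 / 4 : ℝ)))) →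
          eLpNorm (fun x => ∫ τ in Ioo 0 t, ∫ y, oseenKernel (ν * (t - τ)) (x - y) (u τ y) (v τ y))
              3 volume ≤
            ENNReal.ofReal (c * ν ^ (-(1 / 2 : ℝ)) * Ku * Kv) := by
  obtain ⟨C, hC, hS⟩ := exists_eLpNorm_three_oseenSlice_le (E := E)
  set I : ℝ := ∫ s in (0 : ℝ)..1, (1 - s) ^ (-(1 / 2 : ℝ)) * s ^ (-(1 / 2 : ℝ)) with hI
  have hI0 : 0 ≤ I := integral_one_sub_rpow_mul_rpow_nonneg _ _
  refine ⟨C * I, by positivity, fun {ν} hν {u v} hum hvm {Ku Kv} hKu hKv {t} ht hu6 hv6 => ?_⟩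
  set S : ℝ → E → E := fun τ x => ∫ y, oseenKernel (ν * (t - τ)) (x - y) (u τ y) (v τ y) with hSdef
  have hMink := FunctionSpaces.eLpNorm_integral_le_lintegral_eLpNorm (μ := (volume : Measure E))
    (ν := volume.restrict (Ioo 0 t)) (aestronglyMeasurable_oseenIntegrand_swap hum hvm ν t _)
    (p := 3) (by norm_num) (by norm_num)
  have hslice : ∀ τ ∈ Ioo 0 t, eLpNorm (S τ) 3 volume ≤
      ENNReal.ofReal (C * ν ^ (-(1 / 2 : ℝ)) * Ku * Kv * ((t - τ) ^ (-(1 / 2 : ℝ)) * τ ^ (-(1 / 2 : ℝ)))) := by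
    intro τ hτ
    have hστ : 0 < t - τ := sub_pos.2 hτ.2
    have hσ : 0 < ν * (t - τ) := mul_pos hν hστ
    have h1 := hS hσ (measurable_slice hum τ).aestronglyMeasurable
      (measurable_slice hvm τ).aestronglyMeasurable
    refine h1.trans ?_
    calc ENNReal.ofReal (C * (ν * (t - τ)) ^ (-(1 / 2 : ℝ))) * (eLpNorm (u τ) 6 volume * eLpNorm (v τ) 6 volume)
        ≤ ENNReal.ofReal (C * (ν * (t - τ)) ^ (-(1 / 2 : ℝ))) *
            (ENNReal.ofReal (Ku * τ ^ (-(1 / 4 : ℝ))) * ENNReal.ofReal (Kv * τ ^ (-(1 / 4 : ℝ)))) := by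
          gcongr
          · exact hu6 τ hτ
          · exact hv6 τ hτ
      _ = ENNReal.ofReal (C * ν ^ (-(1 / 2 : ℝ)) * Ku * Kv * ((t - τ) ^ (-(1 / 2 : ℝ)) * τ ^ (-(1 / 2 : ℝ)))) := by
          have hτ0 : 0 < τ := hτ.1
          rw [← ENNReal.ofReal_mul (by positivity),
            ← ENNReal.ofReal_mul (mul_nonneg hC (Real.rpow_nonneg hσ.le _))]
          congr 1
          rw [Real.mul_rpow hν.le hστ.le, ← (rpow_quarter_mul hτ.1).1]
          ring
  calc eLpNorm (fun x => ∫ τ in Ioo 0 t, S τ x) 3 volume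
      ≤ ∫⁻ τ in Ioo 0 t, eLpNorm (fun x => S τ x) 3 volume := hMink
    _ ≤ ∫⁻ τ in Ioo 0 t, ENNReal.ofReal (C * ν ^ (-(1 / 2 : ℝ)) * Ku * Kv *
          ((t - τ) ^ (-(1 / 2 : ℝ)) * τ ^ (-(1 / 2 : ℝ)))) :=
        setLIntegral_mono' measurableSet_Ioo fun τ hτ => hslice τ hτ
    _ = ENNReal.ofReal (C * ν ^ (-(1 / 2 : ℝ)) * Ku * Kv * (t ^ (1 - 1 / 2 - 1 / 2 : ℝ) * I)) :=
        lintegral_Ioo_ofReal_sub_rpow_mul_rpow (by norm_num) (by norm_num) (by norm_num) (by norm_num)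
          (by positivity) ht
    _ = ENNReal.ofReal (C * I * ν ^ (-(1 / 2 : ℝ)) * Ku * Kv) := by
        rw [show (1 - 1 / 2 - 1 / 2 : ℝ) = 0 by norm_num, Real.rpow_zero]
        ring_nf

/-- **Kato's pointwise (`L^∞`) estimate of the Oseen–Duhamel term and its absolute convergence**
(Kato 1984, (2.4') with `q = ∞`; Lemarié-Rieusset 2016, proof of Thm. 15.1 (A): "`√t u` is
bounded"): there is an absolute `c` such that for `ν > 0`, jointly measurable `u`, `v` with
`‖u(τ)‖_{L⁶} ≤ K_u τ^{-1/4}` and `‖v(τ)‖_{L^∞} ≤ L_v τ^{-1/2}` on `(0, t)`, the time integrand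
`τ ↦ ∫ K(ν(t-τ), x-y)[u(τ,y), v(τ,y)] dy` is integrable on `(0, t)` for **every** `x`, and
`‖∫_{(0,t)} ∫ K[u, v] dy dτ (x)‖ ≤ c ν^{-3/4} K_u L_v t^{-1/2}` (slice bound `∝ (ν(t-τ))^{-3/4}`,
`∫₀ᵗ (t-τ)^{-3/4} τ^{-3/4} dτ = B t^{-1/2}`). [cite: Kato1984, (2.4')] [cite: LemarieRieusset2016, Thm. 7.5 (proof, (7.40))] -/
theorem exists_norm_oseenDuhamel_le :
    ∃ c : ℝ, 0 ≤ c ∧ ∀ {ν : ℝ}, 0 < ν → ∀ {u v : ℝ → E → E}, Measurable (uncurry u) →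
      Measurable (uncurry v) → ∀ {Ku Lv : ℝ}, 0 ≤ Ku → 0 ≤ Lv → ∀ {t : ℝ}, 0 < t →
        (∀ τ ∈ Ioo 0 t, eLpNorm (u τ) 6 volume ≤ ENNReal.ofReal (Ku * τ ^ (-(1 / 4 : ℝ)))) →
        (∀ τ ∈ Ioo 0 t, eLpNorm (v τ) ∞ volume ≤ ENNReal.ofReal (Lv * τ ^ (-(1 / 2 : ℝ)))) →
          ∀ x : E,
            IntegrableOn (fun τ => ∫ y, oseenKernel (ν * (t - τ)) (x - y) (u τ y) (v τ y))
                (Ioo 0 t) volume ∧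
              ‖∫ τ in Ioo 0 t, ∫ y, oseenKernel (ν * (t - τ)) (x - y) (u τ y) (v τ y)‖ ≤
                c * ν ^ (-(3 / 4 : ℝ)) * Ku * Lv * t ^ (-(1 / 2 : ℝ)) := by
  obtain ⟨C, hC, hS⟩ := exists_enorm_oseenSlice_le hE
  set I : ℝ := ∫ s in (0 : ℝ)..1, (1 - s) ^ (-(3 / 4 : ℝ)) * s ^ (-(3 / 4 : ℝ)) with hI
  have hI0 : 0 ≤ I := integral_one_sub_rpow_mul_rpow_nonneg _ _
  refine ⟨C * I, by positivity, fun {ν} hν {u v} hum hvm {Ku Lv} hKu hLv {t} ht hu6 hv x => ?_⟩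
  set S : ℝ → E → E := fun τ x => ∫ y, oseenKernel (ν * (t - τ)) (x - y) (u τ y) (v τ y) with hSdef
  -- the integrable majorant
  set g : ℝ → ℝ := fun τ => C * ν ^ (-(3 / 4 : ℝ)) * Ku * Lv *
    ((t - τ) ^ (-(3 / 4 : ℝ)) * τ ^ (-(3 / 4 : ℝ))) with hg
  have hgint : IntegrableOn g (Ioo 0 t) volume := by
    have h := (intervalIntegrable_sub_rpow_mul_rpow (a := 3 / 4) (b := 3 / 4) (by norm_num)
      (by norm_num) (by norm_num) (by norm_num) ht).const_mul (C * ν ^ (-(3 / 4 : ℝ)) * Ku * Lv)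
    rw [intervalIntegrable_iff_integrableOn_Ioo_of_le ht.le] at h
    exact h
  have hslice : ∀ τ ∈ Ioo 0 t, ‖S τ x‖ ≤ g τ := by
    intro τ hτ
    have hστ : 0 < t - τ := sub_pos.2 hτ.2
    have hσ : 0 < ν * (t - τ) := mul_pos hν hστ
    have h1 := hS hσ (measurable_slice hum τ).aestronglyMeasurable
      (measurable_slice hvm τ).aestronglyMeasurable x
    have h2 : ‖S τ x‖ₑ ≤ ENNReal.ofReal (g τ) := by
      refine h1.trans ?_
      calc ENNReal.ofReal (C * (ν * (t - τ)) ^ (-(3 / 4 : ℝ))) * (eLpNorm (u τ) 6 volume * eLpNorm (v τ) ∞ volume)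
          ≤ ENNReal.ofReal (C * (ν * (t - τ)) ^ (-(3 / 4 : ℝ))) *
              (ENNReal.ofReal (Ku * τ ^ (-(1 / 4 : ℝ))) * ENNReal.ofReal (Lv * τ ^ (-(1 / 2 : ℝ)))) := by
            gcongr
            · exact hu6 τ hτ
            · exact hv τ hτ
        _ = ENNReal.ofReal (g τ) := by
            have hτ0 : 0 < τ := hτ.1
            rw [← ENNReal.ofReal_mul (by positivity),
              ← ENNReal.ofReal_mul (mul_nonneg hC (Real.rpow_nonneg hσ.le _))]
            congr 1
            simp only [hg]
            rw [Real.mul_rpow hν.le hστ.le, ← (rpow_quarter_mul hτ.1).2]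
            ring
    have hg0 : 0 ≤ g τ := by
      rw [hg]
      exact mul_nonneg (by positivity) (mul_nonneg (Real.rpow_nonneg hστ.le _)
        (Real.rpow_nonneg hτ.1.le _))
    rw [← ofReal_norm] at h2
    exact (ENNReal.ofReal_le_ofReal_iff hg0).1 h2
  have hSxm : AEStronglyMeasurable (fun τ => S τ x) (volume.restrict (Ioo 0 t)) := by
    have h := (stronglyMeasurable_oseenIntegrand hum hvm ν t).comp_measurable
      (measurable_id.prodMk measurable_const : Measurable fun τ : ℝ => (τ, x))
    exact h.aestronglyMeasurable
  have hae : ∀ᵐ τ ∂(volume.restrict (Ioo 0 t)), ‖S τ x‖ ≤ g τ :=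
    (ae_restrict_iff' measurableSet_Ioo).2 (Eventually.of_forall hslice)
  refine ⟨Integrable.mono' hgint hSxm hae, ?_⟩
  calc ‖∫ τ in Ioo 0 t, S τ x‖ ≤ ∫ τ in Ioo 0 t, g τ := norm_integral_le_of_norm_le hgint hae
    _ = C * ν ^ (-(3 / 4 : ℝ)) * Ku * Lv * (t ^ (1 - 3 / 4 - 3 / 4 : ℝ) * I) := by
        rw [hg, integral_const_mul, setIntegral_Ioo_sub_rpow_mul_rpow ht]
    _ = C * I * ν ^ (-(3 / 4 : ℝ)) * Ku * Lv * t ^ (-(1 / 2 : ℝ)) := by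
        rw [show (1 - 3 / 4 - 3 / 4 : ℝ) = -(1 / 2 : ℝ) by norm_num]
        ring

end Duhamel

end Literature.Analysis.FluidPDE

end
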